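import Summits.QuantumFields.YangMills.Theorems.BalabanUVNodesK0S5HBRows164CoreCubeSeq
import Summits.QuantumFields.YangMills.Theorems.BalabanUVNodesN07Letters10OfExtension
import HarnessLib

/-!
# BalabanUVNodes ∕ N07 — S6, THE `HB` SUMMAND OF (159) AT THE OBJECTS, MODULO THE DATA ONLY: **print's three letters of `HB = H_V B` on a window of
# top-level sites of ANY admissible nested family on NODE 00's four-tori, `Letters10On Y η_k t (H_V B)` for every `t > ¼M_Δ·max{4C_dCB₃ε₁, θ·ε_k}`** —
# k0-s1-w3's S5 socket P12 `K0S5HBRows164CoreCubeSeq.hbRows164_core_of_adm22_T4` ([15] (164) for the canonical flat `H` at every REAL datum, (2.60) inside)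
# ∘ FILE 2 `N07Letters10OfExtension.letters10On_extension_of_weightedRowsTop` (kernel identity + duality + weights `= 1`)

Cell `pub-ymgap`, width seat `pub-ymgap-dag-n07-w4` gen 2 (director-ym №197 ∕ HUMAN RULING D-0149), node N07 = [15] = [Balaban1985Variational] (CMP **102** (1985) 277–309);
sub-target S6 of plan g81's `W-SEAT-START-LIST.md` v8 § n07 item 4 (bus INTENT-5 of g2).  `--kind proof --supports stmt-QuantumFields-20542 --as helper`; count-neutral;
def-free; ONE theorem, a composition BY NAME of k0-s1-w3 g3's P12 and this seat's FILE 2; nothing restated.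

WHY.  Print p. 303–304: *«This bound [(160)] and the global bound (152) imply the following bounds on the cube Δ(y₁) … (161) … Then we get on Δ |HB|, |∇^ηHB|,
|∂^{η*}∂^ηHB|, |Δ^ηHB| < ¼M_Δ max{B₃ε₁, ½ε₀}. (164)»* — for the `𝔤`-valued datum `B` and the real operator `H` acting componentwise (p. 288).  In the tree, at door (a)
of n07-e's LOCATED-TOWER (INBOX l.27663: `D := Node00.cubeDomains …` of the print datum; or any admissible `D`): P12 bounds the four weighted rows of `flatH X` at a
top-level bond `b` for every REAL datum `X` with NEAR size `|X c| ≤ C_d·M_Δ·ε₁·(distBI(b,c) + 1)` on the top cells and FAR size `|X c| ≤ C_d·M_Δ·ε(j(c))·L^{k−j(c)}` below,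
given the collar `R′ ≤ distBI(b,c)` to the lower cells and (163′) `8C_dCB₃e^{−δ₁R′} ≤ θ`; FILE 2 turns such rows, for all real data dominated by `‖B‖`, into the three
letters of `H_V B`.  THIS FILE is the one-line composition: the near∕far sizes are asked of `‖B(c)‖` ONCE, and every real component `X = φ ∘ B` inherits them.

WHAT IS PROVED.  ★★★ `letters10On_HB_of_core_adm22_T4 (F : T4Family) (N)`: there are `M_h⁰, R₀` and `C ≥ 0`, `δ₀ > 0`, `δ₁ > 0`, `B₃ > 0` (P12's) such that for all heights
`1 ≤ K − n`, `K − n + 1 ≤ F.m + K`, sizes `M_h = L^{a′} ≥ M_h⁰`, `R ≥ R₀`, `a′ + 3 ≤ F.m + n`, every `D : Domains (F.P K)` with `D.k = K − n` and `Adm22 D R (L·M_h)`, its level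
weights `w`, constants `C_d, M_Δ, ε₁ ≥ 0`, a downward-2-comparable radius family `ε` with `ε(K − n) ≥ 0`, `θ`, `R′` with `8C_dCB₃e^{−δ₁R′} ≤ θ`, every WINDOW `Y` of top-level
sites (`D.InOm (K − n) x`) whose bonds see all lower cells at `distBI ≥ R′`, every componentwise extension `H_V` of `flatH (F.P K) (K − n) D` to `M_N(ℂ)`-valued data (kernel
formula), and every datum `B : 𝔅 → M_N(ℂ)` with the near size on the top cells (from every bond of `Y`) and the far size below: `Letters10On Y η_{K−n} t (H_V B)` for every
`t > ¼M_Δ·max{4C_dCB₃ε₁, θ·ε(K − n)}`.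
HONEST SCOPE: the data sizes (160)∕(155) of `B`, the window's `InOm`∕collar facts (n07-e 39b ∕ k0-s1-w3's twin at `cubeDomains`), `Adm22` and the identification of print's
`HB` with `H_V B` are HYPOTHESES; the content behind P12 is lit-balaban's kernel-checked [Balaban1984PropagatorsII] chain.  Nothing of [15] asserted beyond that; the tokens
`LocalLetters165∕167TopStep(Core)` NOT discharged (this is ONE of three summands); stub 1 ∕ K0⁷ ∕ K1⁷ NOT closed; N07 NOT discharged; counts unmoved (typed 28∕28 · discharged
5∕27); one finite 𝕋⁴ programme at fixed ε — R4 closes the conditional finite-𝕋⁴ rung `BalabanLadder.UV` ONLY; the YM mass gap (Clay) is NOT proved by any of this; nothing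
continuum ∕ ℝ⁴ ∕ OS.  No `def`, no `instance`, no `notation`, no `sorry`.
-/

set_option autoImplicit false

noncomputable section

open scoped BigOperators Matrix.Norms.L2Operator

namespace Summit.QuantumFields.YangMills.BalabanUVNodes.N07LocalLettersHBSummand

open Literature.MathematicalPhysics.QuantumFieldTheory.Balaban1983to89
open Literature.MathematicalPhysics.QuantumFieldTheory.Balaban1983to89.Node00
open B6SectADomainsV1 (Domains)
open B6SectAOperatorsV1 (BondIdx dcE dcsE)
open T4Continuum (T4Family)
open Summit.QuantumFields.YangMills.Theorems.FlatCubeOpsText (Adm22 distBI)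
open Summit.QuantumFields.YangMills.Theorems.K0FlatCubeOpsTextP (IsLevWeight flatH)
open Summit.QuantumFields.YangMills.Theorems.K0S5HBRows164CoreCubeSeq (hbRows164_core_of_adm22_T4)
open Summit.QuantumFields.YangMills.BalabanUVNodes.N07HalvingStepTopOfLocalLetters (Letters10On)
open Summit.QuantumFields.YangMills.BalabanUVNodes.N07Letters10OfExtension (letters10On_extension_of_weightedRowsTop)

open scoped Classical in
/-- ★★★ **[15] (164) ⇒ THE THREE (165)-LETTERS OF `HB = H_V B` ON A WINDOW OF TOP-LEVEL SITES, ANY ADMISSIBLE TOWER ON NODE 00's FOUR-TORI, MODULO THE DATA SIZES**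
(P12 ∘ FILE 2; statement in the header).  The `h₂` input of g0's `letters10On_of_eq159` ∕ `localGauge10On_of_eq159` for the `HB` summand of (159), at the unit `η_{K−n}` of
the window's level. [cite: Balaban1985Variational, (160)–(161) p.303, (163)–(165) p.304, (159) p.303, p.288; Balaban1984PropagatorsII, (2.1)–(2.2) p.224, (2.60) p.234, Cor. 2.8 (2.150)–(2.151) p.249; Balaban1985RegularSpaces, (1.2) p.76, (1.140) p.100] -/
theorem letters10On_HB_of_core_adm22_T4 (F : T4Family) (N : ℕ) [NeZero N] :
    ∃ (Mh₀ R₀ : ℕ) (C δ₀ δ₁ B₃ : ℝ), 0 ≤ C ∧ 0 < δ₀ ∧ 0 < δ₁ ∧ 0 < B₃ ∧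
    ∀ (n K : ℕ) (_ : 1 ≤ K - n) (_ : K - n + 1 ≤ F.m + K) {Mh R a' : ℕ} (_ : Mh = F.L ^ a') (_ : Mh₀ ≤ Mh) (_ : R₀ ≤ R) (_ : a' + 3 ≤ F.m + n)
      (D : Domains (F.P K)) (_ : D.k = K - n) (_ : Adm22 D R (F.L * Mh))
      (w : ℕ → PBond (F.P K) 0 → ℝ) (_ : IsLevWeight (F.P K) (K - n) D w)
      {Cd MΔ ε₁ θ R' : ℝ} {ε : ℕ → ℝ}
      (_ : 0 ≤ Cd) (_ : 0 ≤ MΔ) (_ : 0 ≤ ε₁) (_ : 0 ≤ ε (K - n)) (_ : ∀ j, j < K - n → ε j ≤ 2 * ε (j + 1))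
      (_ : 8 * Cd * C * B₃ * Real.exp (-(δ₁ * R')) ≤ θ)
      {Y : Set (Site (F.P K) 0)} (_ : ∀ x ∈ Y, D.InOm (K - n) x)
      (_ : ∀ b : PBond (F.P K) 0, b.src ∈ Y → ∀ c : BondIdx D, (c.1.1 : ℕ) < K - n → R' ≤ distBI D b c)
      {HV : (BondIdx D → MatA N) →ₗ[ℂ] (PBond (F.P K) 0 → MatA N)}
      (_ : ∀ (A : BondIdx D → MatA N) (b : PBond (F.P K) 0), HV A b = ∑ c, ((flatH (F.P K) (K - n) D (Pi.single c 1) b : ℝ) : ℂ) • A c)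
      {B : BondIdx D → MatA N}
      (_ : ∀ b : PBond (F.P K) 0, b.src ∈ Y → ∀ c : BondIdx D, (c.1.1 : ℕ) = K - n → ‖B c‖ ≤ Cd * MΔ * ε₁ * (distBI D b c + 1))
      (_ : ∀ c : BondIdx D, (c.1.1 : ℕ) < K - n → ‖B c‖ ≤ Cd * MΔ * ε (c.1.1 : ℕ) * ((F.P K).L : ℝ) ^ ((K - n) - (c.1.1 : ℕ)))
      {t : ℝ} (_ : 1 / 4 * MΔ * max (4 * Cd * C * B₃ * ε₁) (θ * ε (K - n)) < t),
      Letters10On Y ((F.P K).eta (K - n)) t (HV B) := by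
  obtain ⟨Mh₀, R₀, C, δ₀, δ₁, B₃, hC, hδ₀, hδ₁, hB₃, hmain⟩ := hbRows164_core_of_adm22_T4 F
  refine ⟨Mh₀, R₀, C, δ₀, δ₁, B₃, hC, hδ₀, hδ₁, hB₃, ?_⟩
  intro n K hk1 hk' Mh R a' hMha hMh hR hsize D hDk hAdm w hw Cd MΔ ε₁ θ R' ε hCd hMΔ hε₁ hεk hcomp h163 Y hY hcollar HV hHv B hBnear hBfar
    t ht
  have hq : 0 ≤ 1 / 4 * MΔ * max (4 * Cd * C * B₃ * ε₁) (θ * ε (K - n)) :=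
    mul_nonneg (mul_nonneg (by norm_num) hMΔ) (le_max_of_le_left (by positivity))
  refine letters10On_extension_of_weightedRowsTop hDk hw hY hq ht (flatH (F.P K) (K - n) D) hHv fun X hX b hb => ?_
  have hrows := hmain n K hk1 hk' hMha hMh hR hsize D hDk hAdm w hw hCd hMΔ hε₁ hεk hcomp h163 (X := X) (b := b) (hY b.src hb)
    (hcollar b hb) (fun c hc => (hX c).trans (hBnear b hb c hc)) (fun c hc => (hX c).trans (hBfar c hc))
  exact ⟨hrows.1, hrows.2.1, hrows.2.2.1⟩

end Summit.QuantumFields.YangMills.BalabanUVNodes.N07LocalLettersHBSummand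

end
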